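import Mathlib.MeasureTheory.Integral.Average
import Mathlib.MeasureTheory.Function.LocallyIntegrable
import Mathlib.Analysis.SpecialFunctions.Gaussian.GaussianIntegral
import Mathlib.Analysis.Calculus.Gradient.Basic
import Mathlib.Analysis.SpecialFunctions.Log.Basic
import Literature.Analysis.FunctionSpaces.LittlewoodPaley
import Literature.Analysis.FunctionSpaces.SobolevDomain
import HarnessLib

-- provenance: harness21/H21/H21/Prelude/Sobolev/BMO.lean @ 83d3230 (interim HEAD d8f2665); M5 mechanical rewrite
/-!
# BMO and the Koch–Tataru space BMO⁻¹

Trunk: Sobolev (outline `H21/Outlines/Sobolev.md`, item C15; notion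
`littlewood_paley_besov_bmo`, part 2).

We define the space `BMO` of functions of *bounded mean oscillation* (John–Nirenberg 1961) on a
(pseudo-)metric measure space, and the Koch–Tataru space `BMO⁻¹` of divergences of `BMO`
vector fields on a finite-dimensional real inner product space `E` (Koch–Tataru, *Well-posedness
for the Navier–Stokes equations*, Adv. Math. 157 (2001), §1 and Theorem 1).

## Mathlib anchors

* `MeasureTheory.average` / `MeasureTheory.laverage` (notations `⨍`, `⨍⁻`), `Metric.ball`,
  `MeasureTheory.LocallyIntegrable`, `gradient`, `MeasureTheory.MemLp`;
* `Literature.Analysis.FunctionSpaces.IsTestFunctionOn` (from `H21/Prelude/Sobolev/SobolevDomain.lean`, the *only* use of that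
  file) for the weak divergence identity;
* `Literature.Analysis.FunctionSpaces.MemHomBesov` (from `H21/Prelude/Sobolev/LittlewoodPaley.lean`) for `BMO⁻¹ ⊂ Ḃ^{-1}_{∞,∞}`.

Mathlib has no `BMO`, no John–Nirenberg inequality and no `BMO⁻¹` (searched `BMO`,
`mean oscillation`, `JohnNirenberg` in `Mathlib/`); they are defined below.

## Main definitions

* `Literature.eBMOSeminorm f μ = sup_{x, r > 0} ⨍_{B(x,r)} ‖f - f_{B(x,r)}‖ ∈ [0, ∞]` and
  `Literature.MemBMO f μ` (locally integrable with finite BMO seminorm).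
* `Literature.HasWeakDivergenceRepresentation u Φ`: `u = div Φ` weakly on `E`.
* `Literature.MemBMOInv u`: `u ∈ BMO⁻¹`, i.e. `u = div Φ` with `Φ ∈ BMO(E; E)` (Koch–Tataru Thm. 1 taken
  as the definition), `Literature.Analysis.FunctionSpaces.MemBMOInvVec` (vector fields, componentwise), `Literature.Analysis.FunctionSpaces.eBMOInvNorm`.
* `Literature.Analysis.FunctionSpaces.BMOInv.heatKernel`, `Literature.Analysis.FunctionSpaces.BMOInv.heatExtension`, `Literature.Analysis.FunctionSpaces.BMOInv.eCarlesonNorm`: the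
  Gauss–Weierstrass kernel, the caloric extension `e^{tΔ} u` and the Carleson-measure quantity
  `sup_{x,R} R^{-d} ∫₀^{R²} ∫_{B(x,R)} |e^{tΔ} u|²` of Koch–Tataru's original definition.

## Main statements (all `sorry`; known results)

* `Literature.Analysis.FunctionSpaces.MemBMO.add`, `Literature.Analysis.FunctionSpaces.memBMO_of_bounded` (= `Literature.Analysis.FunctionSpaces.memBMO_of_memLp_top`, `L^∞ ⊂ BMO`),
  `Literature.Analysis.FunctionSpaces.memBMO_log_norm`
  (`log ‖x‖ ∈ BMO`, John–Nirenberg 1961; Stein, *Harmonic Analysis* IV.1.1.2);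
* `Literature.Analysis.FunctionSpaces.john_nirenberg` (John–Nirenberg 1961, Lemma 1; Stein IV.1.3, Corollary);
* `Literature.Analysis.FunctionSpaces.memBMOInv_of_memLp_dim` (`L^d ⊂ BMO⁻¹`, Koch–Tataru §1);
* `Literature.Analysis.FunctionSpaces.memBMOInv_iff_carleson_heat` (Koch–Tataru Thm. 1: divergence vs. heat characterisation);
* `Literature.Analysis.FunctionSpaces.MemBMOInv.memHomBesov_neg_one_top` (`BMO⁻¹ ⊂ Ḃ^{-1}_{∞,∞}`, Koch–Tataru §1 /
  Bahouri–Chemin–Danchin Prop. 2.39 with Thm. 2.34).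

## Design notes

* `eBMOSeminorm` uses the `ℝ≥0∞`-valued average `⨍⁻ ‖·‖ₑ` of the oscillation (no truncation), but
  the inner ball average `f_B = ⨍_B f` is a Bochner average and is the junk value `0` when `f` is
  not integrable on `B` *or when `F` is not complete*
  (`MeasureTheory.integral_of_not_completeSpace`); hence `MemBMO` carries the guard `LocallyIntegrable f μ` (on a proper space this gives
  integrability on every ball), and the seminorm is only meaningful for `[CompleteSpace F]`
  (for non-complete `F` it degenerates to `sup_B ⨍⁻_B ‖f‖ₑ`); statements whose truth depends on
  this carry `[CompleteSpace F]`. Also, `⨍⁻` over a ball of infinite measure is `0`, so such balls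
  silently drop out of the supremum; this is harmless for locally finite measures (the intended
  use, `volume` on a finite-dimensional space). The measure argument defaults to `volume`.
* `BMO⁻¹` is *defined* through the divergence characterisation `u = ∑ ∂ⱼ Φⱼ`, `Φⱼ ∈ BMO`
  (Koch–Tataru Thm. 1), which needs no Fourier analysis; the heat-kernel (Carleson) description
  is the theorem `memBMOInv_iff_carleson_heat`. Elements of `BMO⁻¹` are modelled as locally
  integrable functions `u : E → ℝ` (enough for the Navier–Stokes statements downstream), not as
  general distributions.
* `Literature.Analysis.FunctionSpaces.BMOInv.heatKernel` deliberately repeats the formula of `Literature.Analysis.UnboundedOperators.heatKernel`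
  (`H21/Prelude/UnbddOp/HeatKernel.lean`) in its own namespace, so that this file does not depend
  on the `UnbddOp` trunk (outline C15); the two agree definitionally. *Debt:* when the trunks
  are merged, replace it by `Literature.Analysis.UnboundedOperators.heatKernel` (or add a glue lemma `BMOInv.heatKernel_eq`).
* The embedding `BMO⁻¹ ⊂ Ḃ^{-1}_{∞,∞}` is stated for a tempered distribution `U : 𝓢'(E, ℂ)`
  representing `u` (hypothesis `hU`), since Mathlib has no `L¹_loc → 𝓢'` map.

## References

* F. John, L. Nirenberg, *On functions of bounded mean oscillation*, CPAM 14 (1961), 415–426.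
* H. Koch, D. Tataru, *Well-posedness for the Navier–Stokes equations*, Adv. Math. 157 (2001).
* E. M. Stein, *Harmonic Analysis* (1993), Chapter IV.
* H. Bahouri, J.-Y. Chemin, R. Danchin, *Fourier Analysis and Nonlinear PDE* (2011), §2.
-/

noncomputable section

open MeasureTheory Metric Filter Topology TopologicalSpace
open scoped ENNReal NNReal RealInnerProductSpace SchwartzMap

namespace Literature.Analysis.FunctionSpaces

/-! ## Bounded mean oscillation -/

section BMO

variable {X : Type*} [PseudoMetricSpace X] [MeasurableSpace X]
variable {F : Type*} [NormedAddCommGroup F] [NormedSpace ℝ F]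

/-- The **BMO seminorm** `‖f‖_* = sup_{x, r > 0} ⨍_{B(x,r)} ‖f(y) - f_{B(x,r)}‖ dμ(y) ∈ [0, ∞]`,
where `f_B = ⨍_B f dμ` is the ball average (John–Nirenberg 1961, (1); Stein, *Harmonic
Analysis* IV.1.1, with balls in place of cubes, an equivalent seminorm). Junk values: the inner
average is a Bochner average, hence `0` if `f ∉ L¹(B)` (see `MemBMO` for the guard) and
identically `0` if `F` is not complete (then the quantity degenerates to `sup_B ⨍⁻_B ‖f‖ₑ`; the
definition is meaningful only under `[CompleteSpace F]`); and `⨍⁻` over a ball of infinite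
`μ`-measure is `0`, so such balls drop out of the supremum (irrelevant for locally finite `μ`). [cite: JohnNirenberg1961, (1] -/
def eBMOSeminorm (f : X → F) (μ : Measure X := by volume_tac) : ℝ≥0∞ :=
  ⨆ (x : X) (r : ℝ) (_ : 0 < r), ⨍⁻ y in ball x r, ‖f y - ⨍ z in ball x r, f z ∂μ‖ₑ ∂μ

/-- `MemBMO f μ`: `f` has **bounded mean oscillation**, `f ∈ BMO(X, μ; F)`: `f` is locally
integrable and `‖f‖_* < ∞` (John–Nirenberg 1961; Stein IV.1.1). Local integrability guards
the junk value of the ball averages in `eBMOSeminorm`. [cite: JohnNirenberg1961] -/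
def MemBMO (f : X → F) (μ : Measure X := by volume_tac) : Prop :=
  LocallyIntegrable f μ ∧ eBMOSeminorm f μ < ∞

/-- A `BMO` function is locally integrable (by definition; Stein IV.1.1). [folklore] -/
theorem MemBMO.locallyIntegrable {f : X → F} {μ : Measure X}
    (hf : MemBMO f μ) : LocallyIntegrable f μ :=
  hf.1

/-- A `BMO` function has finite BMO seminorm (by definition; Stein IV.1.1). [folklore] -/
theorem MemBMO.eBMOSeminorm_lt_top {f : X → F} {μ : Measure X} (hf : MemBMO f μ) :
    eBMOSeminorm f μ < ∞ :=
  hf.2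

/-- The mean oscillation over one ball is bounded by the BMO seminorm (Stein IV.1.1, (1)). [folklore] -/
theorem laverage_oscillation_le_eBMOSeminorm (f : X → F) (μ : Measure X) (x : X) {r : ℝ}
    (hr : 0 < r) :
    ⨍⁻ y in ball x r, ‖f y - ⨍ z in ball x r, f z ∂μ‖ₑ ∂μ ≤ eBMOSeminorm f μ :=
  le_iSup_of_le x (le_iSup₂_of_le r hr le_rfl)

/-- Constants have zero BMO seminorm (Stein IV.1.1.1: `BMO` is a space modulo constants).
Completeness of `F` is needed: otherwise the ball average is the junk value `0`. [cite: SteinHA1993, IV.1.1.1 (BMO modulo constants)] -/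
def eBMOSeminorm_const : Prop :=
  ∀ [CompleteSpace F] (c : F) (μ : Measure X),
    eBMOSeminorm (fun _ : X => c) μ = 0

/-- `BMO` is stable under addition and `‖f + g‖_* ≤ ‖f‖_* + ‖g‖_*` (Stein IV.1.1). [cite: SteinHA1993, IV.1.1] -/
def eBMOSeminorm_add_le : Prop :=
  ∀ [ProperSpace X] {f g : X → F} {μ : Measure X} (hf : LocallyIntegrable f μ) (hg : LocallyIntegrable g μ),
    eBMOSeminorm (f + g) μ ≤ eBMOSeminorm f μ + eBMOSeminorm g μ

/-- `BMO` is stable under addition (Stein IV.1.1). Properness of `X` makes balls relatively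
compact, so that local integrability gives integrability on balls. [cite: SteinHA1993, IV.1.1] -/
def MemBMO.add : Prop :=
  ∀ [ProperSpace X] {f g : X → F} {μ : Measure X} (hf : MemBMO f μ) (hg : MemBMO g μ),
    MemBMO (f + g) μ

/-- `L^∞ ⊂ BMO` with `‖f‖_* ≤ 2 ‖f‖_∞` (Stein IV.1.1.1). [cite: SteinHA1993, IV.1.1.1 (L^∞ ⊂ BMO)] -/
def eBMOSeminorm_le_two_mul_eLpNorm_top : Prop :=
  ∀ (f : X → F) (μ : Measure X),
    eBMOSeminorm f μ ≤ 2 * eLpNorm f ∞ μ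

/-- `L^∞ ⊂ BMO` (Stein IV.1.1.1). Name prescribed by the outline; see also the alias
`memBMO_of_memLp_top`. [folklore] -/
def memBMO_of_bounded : Prop :=
  ∀ {f : X → F} {μ : Measure X} [IsLocallyFiniteMeasure μ] (hf : MemLp f ∞ μ),
    MemBMO f μ

/- interim proof relied on results that are now named facts (D-0014); demoted to a fact by the M5 import, proof preserved:
:=
  ⟨hf.locallyIntegrable le_top, (eBMOSeminorm_le_two_mul_eLpNorm_top f μ).trans_lt
    (ENNReal.mul_lt_top (by simp) hf.eLpNorm_lt_top)⟩
-/

/-- `L^∞ ⊂ BMO` (Stein IV.1.1.1); Mathlib-style name for `memBMO_of_bounded`. [folklore] -/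
def memBMO_of_memLp_top : Prop :=
  ∀ {f : X → F} {μ : Measure X} [IsLocallyFiniteMeasure μ] (hf : MemLp f ∞ μ),
    MemBMO f μ

/- interim proof relied on results that are now named facts (D-0014); demoted to a fact by the M5 import, proof preserved:
:=
  memBMO_of_bounded hf
-/

end BMO

/-! ## Examples and the John–Nirenberg inequality on Euclidean space -/

section Euclidean

/-- The unbounded function `log ‖x‖` belongs to `BMO(E)` (John–Nirenberg 1961, §1, example;
Stein IV.1.1.2). For `E = {0}` the function is the constant `0`. [cite: JohnNirenberg1961, §1  example] -/
def memBMO_log_norm : Prop :=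
  ∀ (E : Type*) [NormedAddCommGroup E] [InnerProductSpace ℝ E] [FiniteDimensional ℝ E] [MeasurableSpace E] [BorelSpace E],
    MemBMO (fun x : E => Real.log ‖x‖)

/-- The **John–Nirenberg inequality** (John–Nirenberg 1961, Lemma 1'; Stein IV.1.3, Corollary of
Theorem 1): there are constants `c₁, c₂ > 0` depending only on `E` such that for every
`f ∈ BMO(E; F)`, every ball `B` and every `t > 0`,
`|{x ∈ B : ‖f(x) - f_B‖ > t ‖f‖_*}| ≤ c₁ e^{-c₂ t} |B|`. (Stated with the threshold `t ‖f‖_*`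
so that no division by `‖f‖_*` occurs; for `‖f‖_* = 0` the left-hand side vanishes.) `E` and
`F` are explicit since they occur in no other argument; `F` is complete as for all Bochner
statements. [cite: JohnNirenberg1961, Lemma 1'] -/
def john_nirenberg : Prop :=
  ∀ (E : Type*) [NormedAddCommGroup E] [InnerProductSpace ℝ E] [FiniteDimensional ℝ E] [MeasurableSpace E] [BorelSpace E] (F : Type*) [NormedAddCommGroup F] [NormedSpace ℝ F] [CompleteSpace F],
    ∃ c₁ c₂ : ℝ, 0 < c₁ ∧ 0 < c₂ ∧ ∀ (f : E → F), MemBMO f →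
      ∀ (x₀ : E) (r : ℝ), 0 < r → ∀ (t : ℝ), 0 < t →
        volume {x ∈ ball x₀ r |
            ENNReal.ofReal t * eBMOSeminorm f < ‖f x - ⨍ z in ball x₀ r, f z‖ₑ} ≤
          ENNReal.ofReal (c₁ * Real.exp (-c₂ * t)) * volume (ball x₀ r)

end Euclidean

/-! ## The Koch–Tataru space `BMO⁻¹` -/

section BMOInv

variable {E : Type*} [NormedAddCommGroup E] [InnerProductSpace ℝ E] [FiniteDimensional ℝ E]
  [MeasurableSpace E] [BorelSpace E]

/-- `HasWeakDivergenceRepresentation u Φ`: the scalar function `u : E → ℝ` is the **weak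
divergence** of the vector field `Φ : E → E`, `u = div Φ = ∑ⱼ ∂ⱼ Φⱼ` in `𝓓'(E)`: both are
locally integrable and `∫ u φ = -∫ ⟪Φ, ∇φ⟫` for every test function `φ ∈ C_c^∞(E)`
(Koch–Tataru 2001, Theorem 1, the representation `u = ∑ ∂ⱼ fⱼ`). [cite: KochTataru2001, Theorem 1  the representation  u = ∑ ∂ⱼ] -/
structure HasWeakDivergenceRepresentation (u : E → ℝ) (Φ : E → E) : Prop where
  /-- The divergence is locally integrable. -/
  locallyIntegrable : LocallyIntegrable u
  /-- The vector field is locally integrable. -/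
  locallyIntegrable_field : LocallyIntegrable Φ
  /-- The weak divergence identity against test functions. -/
  integral_mul_eq : ∀ φ : E → ℝ, IsTestFunctionOn ⊤ φ →
    ∫ x, u x * φ x = -∫ x, ⟪Φ x, gradient φ x⟫

/-- The zero field represents the zero function (trivial; Koch–Tataru 2001, §1). [cite: KochTataru2001, §1] -/
theorem hasWeakDivergenceRepresentation_zero :
    HasWeakDivergenceRepresentation (0 : E → ℝ) (0 : E → E) where
  locallyIntegrable := locallyIntegrable_zero
  locallyIntegrable_field := locallyIntegrable_zero
  integral_mul_eq φ _ := by simp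

/-- `MemBMOInv u`: `u ∈ BMO⁻¹(E)`, the Koch–Tataru space, defined through the divergence
characterisation (Koch–Tataru 2001, Theorem 1): `u = div Φ` weakly for a vector field `Φ` all of
whose components `⟪Φ, v⟫` are in `BMO`. Equivalent to the heat-kernel definition
(`memBMOInv_iff_carleson_heat`). [cite: KochTataru2001, Theorem 1] -/
def MemBMOInv (u : E → ℝ) : Prop :=
  ∃ Φ : E → E, (∀ v : E, MemBMO (fun x => ⟪Φ x, v⟫)) ∧ HasWeakDivergenceRepresentation u Φ

/-- `MemBMOInvVec u`: the vector field `u : E → E` is in `BMO⁻¹(E; E)`, i.e. every component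
`⟪u, v⟫` is in `BMO⁻¹` (Koch–Tataru 2001, Theorem 2, the space of initial data). [cite: KochTataru2001, Theorem 2  the space of initial data] -/
def MemBMOInvVec (u : E → E) : Prop :=
  ∀ v : E, MemBMOInv (fun x => ⟪u x, v⟫)

/-- The `BMO` seminorm of a vector field `Φ : E → E`, `sup_{‖v‖ ≤ 1} ‖⟪Φ, v⟫‖_*`
(Koch–Tataru 2001, §1). [cite: KochTataru2001, §1] -/
def eBMOSeminormVec (Φ : E → E) : ℝ≥0∞ :=
  ⨆ (v : E) (_ : ‖v‖ ≤ 1), eBMOSeminorm (fun x => ⟪Φ x, v⟫)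

/-- The **`BMO⁻¹` norm** `‖u‖_{BMO⁻¹} = inf {‖Φ‖_{BMO} : u = div Φ} ∈ [0, ∞]`
(Koch–Tataru 2001, Theorem 1); `∞` when `u` has no divergence representation. [cite: KochTataru2001, Theorem 1] -/
def eBMOInvNorm (u : E → ℝ) : ℝ≥0∞ :=
  ⨅ (Φ : E → E) (_ : HasWeakDivergenceRepresentation u Φ), eBMOSeminormVec Φ

/-- `0 ∈ BMO⁻¹` (Koch–Tataru 2001, §1). [cite: KochTataru2001, §1] -/
def memBMOInv_zero : Prop :=
  MemBMOInv (0 : E → ℝ)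

/- interim proof relied on results that are now named facts (D-0014); demoted to a fact by the M5 import, proof preserved:
:=
  ⟨0, fun v => by
    simpa using memBMO_of_bounded (f := fun _ : E => (0 : ℝ)) (μ := volume) (memLp_top_const 0),
    hasWeakDivergenceRepresentation_zero⟩
-/

/-- A function in `BMO⁻¹` has finite `BMO⁻¹` norm (Koch–Tataru 2001, Theorem 1). [cite: KochTataru2001, Theorem 1] -/
def MemBMOInv.eBMOInvNorm_lt_top : Prop :=
  ∀ {u : E → ℝ} (hu : MemBMOInv u),
    eBMOInvNorm u < ∞

/-- `u ∈ BMO⁻¹` iff its `BMO⁻¹` norm is finite (Koch–Tataru 2001, Theorem 1); the converse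
direction uses that local integrability of `Φ` is part of `HasWeakDivergenceRepresentation` and
that finiteness of `sup_{‖v‖ ≤ 1} ‖⟪Φ, v⟫‖_*` gives `⟪Φ, v⟫ ∈ BMO` for every `v` by scaling. [cite: KochTataru2001, Theorem 1] -/
def memBMOInv_iff_eBMOInvNorm_lt_top : Prop :=
  ∀ {u : E → ℝ},
    MemBMOInv u ↔ eBMOInvNorm u < ∞

/-- `BMO⁻¹` is stable under addition (Koch–Tataru 2001, §1: it is a normed space). [cite: KochTataru2001, §1: it is a normed space] -/
def MemBMOInv.add : Prop :=
  ∀ {u v : E → ℝ} (hu : MemBMOInv u) (hv : MemBMOInv v),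
    MemBMOInv (u + v)

/-- `L^d(ℝ^d) ⊂ BMO⁻¹`, `d = dim E ≥ 1` (Koch–Tataru 2001, §1: `L^n ⊂ Ḃ^{-1+n/p}_{p,∞} ⊂ BMO⁻¹`;
directly, `u = div ∇(-Δ)⁻¹(-u)` with `∇(-Δ)⁻¹ u ∈ Ẇ^{1,d} ⊂ BMO`). [cite: KochTataru2001, §1:  L^n ⊂ Ḃ^{-1+n/p}_{p ∞} ⊂ BMO⁻¹] -/
def memBMOInv_of_memLp_dim : Prop :=
  ∀ [Nontrivial E] {u : E → ℝ} (hu : MemLp u (Module.finrank ℝ E : ℝ≥0∞)),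
    MemBMOInv u

namespace BMOInv

/-- The Gauss–Weierstrass **heat kernel** `(4πt)^{-d/2} exp (-‖x‖² / (4t))`, `d = dim E`
(Evans, *PDE*, §2.3.1). Same formula as `Literature.Analysis.UnboundedOperators.heatKernel` in
`H21/Prelude/UnbddOp/HeatKernel.lean`, repeated here to keep the Sobolev trunk independent of the
`UnbddOp` trunk. Junk for `t ≤ 0`. [folklore] -/
def heatKernel (t : ℝ) (x : E) : ℝ :=
  (4 * Real.pi * t) ^ (-(Module.finrank ℝ E : ℝ) / 2) * Real.exp (-‖x‖ ^ 2 / (4 * t))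

/-- The caloric extension `e^{tΔ} u (x) = ∫ heatKernel t (x - y) u(y) dy` of `u : E → ℝ`
(Koch–Tataru 2001, (2)); junk (`0`) where the integral diverges. [cite: KochTataru2001, (2] -/
def heatExtension (u : E → ℝ) (t : ℝ) (x : E) : ℝ :=
  ∫ y, heatKernel t (x - y) * u y

/-- Koch–Tataru's Carleson quantity
`sup_{x, R > 0} R^{-d} ∫₀^{R²} ∫_{B(x,R)} |e^{tΔ} u (y)|² dy dt ∈ [0, ∞]`, the square of the
principal part of the `BMO⁻¹` norm (Koch–Tataru 2001, (3) and Theorem 1). [cite: KochTataru2001, (3] -/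
def eCarlesonNorm (u : E → ℝ) : ℝ≥0∞ :=
  ⨆ (x : E) (R : ℝ) (_ : 0 < R), (ENNReal.ofReal (R ^ Module.finrank ℝ E))⁻¹ *
    ∫⁻ t in Set.Ioo 0 (R ^ 2), ∫⁻ y in ball x R, ‖heatExtension u t y‖ₑ ^ 2

end BMOInv

open BMOInv in
/-- **Koch–Tataru's Theorem 1** (Adv. Math. 157 (2001), Theorem 1): for a locally integrable `u`
that is integrable against some polynomial weight `(1 + ‖y‖²)^{-N}` (so that `u` is a tempered
distribution and its caloric extension `e^{tΔ} u` is given by the absolutely convergent integrals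
`heatExtension u t`), `u ∈ BMO⁻¹` (divergence form, `MemBMOInv`) if and only if
`sup_{x, R > 0} R^{-d} ∫₀^{R²} ∫_{B(x,R)} |e^{tΔ} u|² dy dt < ∞`. [cite: KochTataruAdvMath2001, Theorem 1] -/
def memBMOInv_iff_carleson_heat : Prop :=
  ∀ {u : E → ℝ} (hu : LocallyIntegrable u) (htemp : ∃ N : ℕ, Integrable fun y => ((1 + ‖y‖ ^ 2) ^ N)⁻¹ * u y),
    MemBMOInv u ↔ eCarlesonNorm u < ∞

/-- **`BMO⁻¹ ⊂ Ḃ^{-1}_{∞,∞}`** (Koch–Tataru 2001, §1; Bahouri–Chemin–Danchin 2011, end of §2.3 /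
Prop. 2.39): if `u ∈ BMO⁻¹` and `U ∈ 𝓢'(E, ℂ)` is the tempered distribution given by
integration against `u` (hypothesis `hU`, standing in for the `L¹_loc → 𝓢'` embedding that
Mathlib lacks), then `U ∈ Ḃ^{-1}_{∞,∞}`. [cite: KochTataru2001, §1] -/
def MemBMOInv.memHomBesov_neg_one_top : Prop :=
  ∀ {u : E → ℝ} (hu : MemBMOInv u) (U : 𝓢'(E, ℂ)) (hU : ∀ φ : 𝓢(E, ℂ), Integrable (fun x => φ x * u x) ∧ U φ = ∫ x, φ x * u x),
    MemHomBesov (-1) ∞ ∞ U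

end BMOInv

end Literature.Analysis.FunctionSpaces
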